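import Summits.Ventures.DiscreteObjects.Hadamard.InvolutionTools

/-!
# No negacyclic ±1 matrix `N` of order `n ≡ 4 (mod 8)` satisfies `N Nᵀ = n I` (kernel, general)

Framing: lottery ticket; floor = certified bounds/negative ranges.

Cell pub-namedobj (venture DiscreteObjects), target (H), hadamard gen 12.  The obstruction behind 'no automorphism of order 668':
**`no_negacyclic_pm_seq`** — there is no `±1` sequence `f : ℕ → ℤ` that is `n`-ANTIperiodic (`f (t + n) = −f t`) with
vanishing negaperiodic autocorrelation `Σ_{m<n} f m · f (m + j) = 0` for `0 < j < n`, when `n ≡ 4 (mod 8)`; equivalently no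
negacyclic `±1` matrix of such an order `n` has `N Nᵀ = n I` (array form `no_negacyclic_array`: shift-invariant `±1` array,
antiperiodic in both variables, with orthogonal rows).
Proof (compression to order 4, ours/elementary): let `J` be the `4 × 4` negacyclic shift (`J⁴ = −1`, `J Jᵀ = 1`) and
`S = Σ_{m<n} f m · J^m`.  Since `n ≡ 4 (mod 8)`, `(Jᵀ)^n = −1`, so `t ↦ f t · (Jᵀ)^t` is `n`-periodic and
`S Sᵀ = Σ_j (Σ_m f m f (m+j)) · (Jᵀ)^j = n · 1`.  But `S` commutes with `J` (it is negacyclic of order `4`) and every entry of `S`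
is odd (each entry is a `±1`-sum over the `n/4` — odd — indices in one residue class mod `4`), and for a negacyclic
`4 × 4` matrix with odd first column `(a, b, c, d)` the entry `(S Sᵀ)₀₁ = ab + bc + cd − ad ≡ 2 (mod 4)` is never `0`.
(In cyclotomic language: `|Σ f_m ζ₈^m|² = n` is impossible in `ℤ[ζ₈]` with odd coordinates.)  Ours, not literature; no `sorry`.
-/

namespace Summit.Ventures.DiscreteObjects.Hadamard

open Finset BigOperators Matrix

-- The negacyclic shift of order 4, `J e_j = e_{j+1}` (`j < 3`), `J e_3 = −e_0`, is written out literally as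
-- `!![0, 0, 0, -1; 1, 0, 0, 0; 0, 1, 0, 0; 0, 0, 1, 0]` throughout (no definition, no notation: fast-lane file).

section negashift


/-- `J Jᵀ = 1` -/
lemma negJ_mul_transpose : (!![0, 0, 0, -1; 1, 0, 0, 0; 0, 1, 0, 0; 0, 0, 1, 0] : Matrix (Fin 4) (Fin 4) ℤ) * (!![0, 0, 0, -1; 1, 0, 0, 0; 0, 1, 0, 0; 0, 0, 1, 0] : Matrix (Fin 4) (Fin 4) ℤ)ᵀ = 1 := by
  ext i j
  fin_cases i <;> fin_cases j <;> simp [Matrix.mul_apply, Fin.sum_univ_four]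

/-- `Jᵀ J = 1` -/
lemma negJ_transpose_mul : (!![0, 0, 0, -1; 1, 0, 0, 0; 0, 1, 0, 0; 0, 0, 1, 0] : Matrix (Fin 4) (Fin 4) ℤ)ᵀ * (!![0, 0, 0, -1; 1, 0, 0, 0; 0, 1, 0, 0; 0, 0, 1, 0] : Matrix (Fin 4) (Fin 4) ℤ) = 1 := by
  ext i j
  fin_cases i <;> fin_cases j <;> simp [Matrix.mul_apply, Fin.sum_univ_four]

/-- `J²` explicitly -/
lemma negJ_sq : (!![0, 0, 0, -1; 1, 0, 0, 0; 0, 1, 0, 0; 0, 0, 1, 0] : Matrix (Fin 4) (Fin 4) ℤ) ^ 2 = !![0, 0, -1, 0; 0, 0, 0, -1; 1, 0, 0, 0; 0, 1, 0, 0] := by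
  ext i j
  rw [pow_two]
  fin_cases i <;> fin_cases j <;> simp [Matrix.mul_apply, Fin.sum_univ_four]

/-- `J⁴ = −1` -/
lemma negJ_pow_four : (!![0, 0, 0, -1; 1, 0, 0, 0; 0, 1, 0, 0; 0, 0, 1, 0] : Matrix (Fin 4) (Fin 4) ℤ) ^ 4 = -1 := by
  have e : (!![0, 0, 0, -1; 1, 0, 0, 0; 0, 1, 0, 0; 0, 0, 1, 0] : Matrix (Fin 4) (Fin 4) ℤ) ^ 4 = (!![0, 0, 0, -1; 1, 0, 0, 0; 0, 1, 0, 0; 0, 0, 1, 0] : Matrix (Fin 4) (Fin 4) ℤ) ^ 2 * (!![0, 0, 0, -1; 1, 0, 0, 0; 0, 1, 0, 0; 0, 0, 1, 0] : Matrix (Fin 4) (Fin 4) ℤ) ^ 2 := by rw [← pow_add]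
  rw [e, negJ_sq]
  ext i j
  fin_cases i <;> fin_cases j <;> simp [Matrix.mul_apply, Fin.sum_univ_four]

/-- `J` commutes with `Jᵀ` -/
lemma negJ_commute_transpose : Commute (!![0, 0, 0, -1; 1, 0, 0, 0; 0, 1, 0, 0; 0, 0, 1, 0] : Matrix (Fin 4) (Fin 4) ℤ) (!![0, 0, 0, -1; 1, 0, 0, 0; 0, 1, 0, 0; 0, 0, 1, 0] : Matrix (Fin 4) (Fin 4) ℤ)ᵀ := by
  rw [Commute, SemiconjBy, negJ_mul_transpose, negJ_transpose_mul]

/-- `(Jᵀ)^n = −1` for `n ≡ 4 (mod 8)` -/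
lemma negJ_transpose_pow (n : ℕ) (hn : n % 8 = 4) : ((!![0, 0, 0, -1; 1, 0, 0, 0; 0, 1, 0, 0; 0, 0, 1, 0] : Matrix (Fin 4) (Fin 4) ℤ)ᵀ) ^ n = -1 := by
  have h4 : ((!![0, 0, 0, -1; 1, 0, 0, 0; 0, 1, 0, 0; 0, 0, 1, 0] : Matrix (Fin 4) (Fin 4) ℤ)ᵀ) ^ 4 = -1 := by
    rw [← Matrix.transpose_pow, negJ_pow_four]
    ext i j
    simp [Matrix.transpose_apply, Matrix.neg_apply, Matrix.one_apply, eq_comm]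
  have h8 : ((!![0, 0, 0, -1; 1, 0, 0, 0; 0, 1, 0, 0; 0, 0, 1, 0] : Matrix (Fin 4) (Fin 4) ℤ)ᵀ) ^ 8 = 1 := by
    rw [show (8 : ℕ) = 4 + 4 from rfl, pow_add, h4]; simp
  obtain ⟨u, rfl⟩ : ∃ u, n = 8 * u + 4 := ⟨n / 8, by omega⟩
  rw [pow_add, pow_mul, h8, one_pow, one_mul, h4]

/-- `J^m (Jᵀ)^m = 1` -/
lemma negJ_pow_mul_transpose_pow (m : ℕ) : (!![0, 0, 0, -1; 1, 0, 0, 0; 0, 1, 0, 0; 0, 0, 1, 0] : Matrix (Fin 4) (Fin 4) ℤ) ^ m * ((!![0, 0, 0, -1; 1, 0, 0, 0; 0, 1, 0, 0; 0, 0, 1, 0] : Matrix (Fin 4) (Fin 4) ℤ)ᵀ) ^ m = 1 := by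
  rw [← negJ_commute_transpose.mul_pow, negJ_mul_transpose, one_pow]

/-- first column of `J^m`: `e_{m mod 8}` with a sign flip in the second half of the period -/
lemma negJ_pow_col (m : ℕ) (i : Fin 4) :
    ((!![0, 0, 0, -1; 1, 0, 0, 0; 0, 1, 0, 0; 0, 0, 1, 0] : Matrix (Fin 4) (Fin 4) ℤ) ^ m) i 0 = if m % 8 = i.1 then 1 else if m % 8 = i.1 + 4 then -1 else 0 := by
  induction m generalizing i with
  | zero => fin_cases i <;> simp
  | succ m ih =>
    rw [pow_succ', Matrix.mul_apply, Fin.sum_univ_four, ih 0, ih 1, ih 2, ih 3]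
    fin_cases i <;> simp <;> split_ifs <;> omega

end negashift

section periodic

/-- a sum over one period of an `n`-periodic function can be shifted -/
lemma sum_range_shift_of_periodic {M : Type*} [AddCommMonoid M] (n : ℕ) (G : ℕ → M) (hG : ∀ t, G (t + n) = G t) (m : ℕ) :
    ∑ t ∈ range n, G (m + t) = ∑ t ∈ range n, G t := by
  induction m with
  | zero => simp
  | succ m ih =>
    rw [← ih]
    rcases Nat.eq_zero_or_pos n with hn | hn
    · subst hn; simp
    · obtain ⟨n', rfl⟩ : ∃ n', n = n' + 1 := ⟨n - 1, by omega⟩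
      rw [Finset.sum_range_succ (fun t => G (m + 1 + t)), Finset.sum_range_succ' (fun t => G (m + t))]
      congr 1
      · exact Finset.sum_congr rfl fun t _ => by rw [show m + 1 + t = m + (t + 1) by ring]
      · rw [add_zero, show m + 1 + n' = m + (n' + 1) by ring, hG]

end periodic

section parity

/-- a sum of odd integers over a finite set has the parity of the number of terms -/
lemma sum_odd_parity {α : Type*} (s : Finset α) (g : α → ℤ) (hg : ∀ a ∈ s, g a % 2 = 1) :
    (∑ a ∈ s, g a) % 2 = (s.card : ℤ) % 2 := by
  classical
  induction s using Finset.induction_on with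
  | empty => simp
  | insert a s ha ih =>
    rw [Finset.sum_insert ha, Finset.card_insert_of_notMem ha]
    have h1 := hg a (Finset.mem_insert_self a s)
    have h2 := ih (fun b hb => hg b (Finset.mem_insert_of_mem hb))
    push_cast
    omega

/-- the number of `m < 4w` in a fixed residue class mod `4` is `w` -/
lemma card_filter_range_mod_four (w i : ℕ) (hi : i < 4) :
    ((range (4 * w)).filter fun m => m % 4 = i).card = w := by
  have h : (range (4 * w)).filter (fun m => m % 4 = i)
      = (range w).map ⟨fun j => 4 * j + i, fun a b hab => by simp only at hab; omega⟩ := by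
    ext m
    simp only [Finset.mem_filter, Finset.mem_range, Finset.mem_map, Function.Embedding.coeFn_mk]
    constructor
    · rintro ⟨hm, hmi⟩
      exact ⟨m / 4, by omega, by omega⟩
    · rintro ⟨j, hj, rfl⟩
      exact ⟨by omega, by omega⟩
  rw [h, Finset.card_map, Finset.card_range]

/-- **parity endgame**: four odd integers never satisfy `ab + bc + cd − ad = 0` (the value is `≡ 2 mod 4`) -/
lemma odd_quad_ne_zero {a b c d : ℤ} (ha : a % 2 = 1) (hb : b % 2 = 1) (hc : c % 2 = 1) (hd : d % 2 = 1) :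
    a * b + b * c + c * d - a * d ≠ 0 := by
  intro h
  obtain ⟨p, rfl⟩ : ∃ p, a = 2 * p + 1 := ⟨a / 2, by omega⟩
  obtain ⟨q, rfl⟩ : ∃ q, b = 2 * q + 1 := ⟨b / 2, by omega⟩
  obtain ⟨r, rfl⟩ : ∃ r, c = 2 * r + 1 := ⟨c / 2, by omega⟩
  obtain ⟨s, rfl⟩ : ∃ s, d = 2 * s + 1 := ⟨d / 2, by omega⟩
  have key : ∀ p q r s : ZMod 4,
      (2 * p + 1) * (2 * q + 1) + (2 * q + 1) * (2 * r + 1) + (2 * r + 1) * (2 * s + 1) - (2 * p + 1) * (2 * s + 1) ≠ 0 := by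
    decide
  apply key (p : ZMod 4) (q : ZMod 4) (r : ZMod 4) (s : ZMod 4)
  have := congrArg (Int.cast : ℤ → ZMod 4) h
  push_cast at this
  exact this

end parity

section main

/-- **No `n`-antiperiodic `±1` sequence with vanishing negaperiodic autocorrelation, `n ≡ 4 (mod 8)`.** -/
theorem no_negacyclic_pm_seq (n : ℕ) (hn : n % 8 = 4) (f : ℕ → ℤ) (hf : ∀ t, f t = 1 ∨ f t = -1)
    (hanti : ∀ t, f (t + n) = -f t) (horth : ∀ j, 0 < j → j < n → ∑ m ∈ range n, f m * f (m + j) = 0) : False := by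
  -- the compressed matrix S = Σ f m J^m and the product identity S Sᵀ = n
  set S : Matrix (Fin 4) (Fin 4) ℤ := ∑ m ∈ range n, f m • (!![0, 0, 0, -1; 1, 0, 0, 0; 0, 1, 0, 0; 0, 0, 1, 0] : Matrix (Fin 4) (Fin 4) ℤ) ^ m with hSdef
  set T : Matrix (Fin 4) (Fin 4) ℤ := ∑ t ∈ range n, f t • ((!![0, 0, 0, -1; 1, 0, 0, 0; 0, 1, 0, 0; 0, 0, 1, 0] : Matrix (Fin 4) (Fin 4) ℤ)ᵀ) ^ t with hTdef
  have hTS : ∀ i j, T i j = S j i := by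
    intro i j
    simp only [hSdef, hTdef, Matrix.sum_apply, Matrix.smul_apply, smul_eq_mul]
    refine Finset.sum_congr rfl fun t _ => ?_
    rw [← Matrix.transpose_pow, Matrix.transpose_apply]
  have hST : S * T = (n : ℤ) • (1 : Matrix (Fin 4) (Fin 4) ℤ) := by
    have hper : ∀ m t, f (t + n) • ((!![0, 0, 0, -1; 1, 0, 0, 0; 0, 1, 0, 0; 0, 0, 1, 0] : Matrix (Fin 4) (Fin 4) ℤ) ^ m * ((!![0, 0, 0, -1; 1, 0, 0, 0; 0, 1, 0, 0; 0, 0, 1, 0] : Matrix (Fin 4) (Fin 4) ℤ)ᵀ) ^ (t + n)) = f t • ((!![0, 0, 0, -1; 1, 0, 0, 0; 0, 1, 0, 0; 0, 0, 1, 0] : Matrix (Fin 4) (Fin 4) ℤ) ^ m * ((!![0, 0, 0, -1; 1, 0, 0, 0; 0, 1, 0, 0; 0, 0, 1, 0] : Matrix (Fin 4) (Fin 4) ℤ)ᵀ) ^ t) := by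
      intro m t
      rw [hanti, pow_add, negJ_transpose_pow n hn, ← mul_assoc]
      simp
    calc S * T = ∑ m ∈ range n, f m • ((!![0, 0, 0, -1; 1, 0, 0, 0; 0, 1, 0, 0; 0, 0, 1, 0] : Matrix (Fin 4) (Fin 4) ℤ) ^ m * T) := by
            rw [hSdef, Finset.sum_mul]
            exact Finset.sum_congr rfl fun m _ => smul_mul_assoc _ _ _
      _ = ∑ m ∈ range n, f m • ∑ t ∈ range n, f t • ((!![0, 0, 0, -1; 1, 0, 0, 0; 0, 1, 0, 0; 0, 0, 1, 0] : Matrix (Fin 4) (Fin 4) ℤ) ^ m * ((!![0, 0, 0, -1; 1, 0, 0, 0; 0, 1, 0, 0; 0, 0, 1, 0] : Matrix (Fin 4) (Fin 4) ℤ)ᵀ) ^ t) := by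
            refine Finset.sum_congr rfl fun m _ => ?_
            rw [hTdef, Finset.mul_sum]
            congr 1
            exact Finset.sum_congr rfl fun t _ => mul_smul_comm _ _ _
      _ = ∑ m ∈ range n, f m • ∑ j ∈ range n, f (m + j) • ((!![0, 0, 0, -1; 1, 0, 0, 0; 0, 1, 0, 0; 0, 0, 1, 0] : Matrix (Fin 4) (Fin 4) ℤ)ᵀ) ^ j := by
            refine Finset.sum_congr rfl fun m _ => ?_
            congr 1
            rw [← sum_range_shift_of_periodic n (fun t => f t • ((!![0, 0, 0, -1; 1, 0, 0, 0; 0, 1, 0, 0; 0, 0, 1, 0] : Matrix (Fin 4) (Fin 4) ℤ) ^ m * ((!![0, 0, 0, -1; 1, 0, 0, 0; 0, 1, 0, 0; 0, 0, 1, 0] : Matrix (Fin 4) (Fin 4) ℤ)ᵀ) ^ t)) (hper m) m]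
            refine Finset.sum_congr rfl fun j _ => ?_
            show f (m + j) • ((!![0, 0, 0, -1; 1, 0, 0, 0; 0, 1, 0, 0; 0, 0, 1, 0] : Matrix (Fin 4) (Fin 4) ℤ) ^ m * ((!![0, 0, 0, -1; 1, 0, 0, 0; 0, 1, 0, 0; 0, 0, 1, 0] : Matrix (Fin 4) (Fin 4) ℤ)ᵀ) ^ (m + j)) = f (m + j) • ((!![0, 0, 0, -1; 1, 0, 0, 0; 0, 1, 0, 0; 0, 0, 1, 0] : Matrix (Fin 4) (Fin 4) ℤ)ᵀ) ^ j
            rw [pow_add, ← mul_assoc, negJ_pow_mul_transpose_pow, one_mul]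
      _ = ∑ j ∈ range n, (∑ m ∈ range n, f m * f (m + j)) • ((!![0, 0, 0, -1; 1, 0, 0, 0; 0, 1, 0, 0; 0, 0, 1, 0] : Matrix (Fin 4) (Fin 4) ℤ)ᵀ) ^ j := by
            have e : ∀ m, f m • ∑ j ∈ range n, f (m + j) • ((!![0, 0, 0, -1; 1, 0, 0, 0; 0, 1, 0, 0; 0, 0, 1, 0] : Matrix (Fin 4) (Fin 4) ℤ)ᵀ) ^ j
                = ∑ j ∈ range n, (f m * f (m + j)) • ((!![0, 0, 0, -1; 1, 0, 0, 0; 0, 1, 0, 0; 0, 0, 1, 0] : Matrix (Fin 4) (Fin 4) ℤ)ᵀ) ^ j := by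
              intro m
              rw [Finset.smul_sum]
              exact Finset.sum_congr rfl fun j _ => smul_smul _ _ _
            rw [Finset.sum_congr rfl fun m _ => e m, Finset.sum_comm]
            exact Finset.sum_congr rfl fun j _ => (Finset.sum_smul).symm
      _ = (n : ℤ) • 1 := by
            obtain ⟨n', rfl⟩ : ∃ n', n = n' + 1 := ⟨n - 1, by omega⟩
            rw [Finset.sum_range_succ']
            have hzero : ∑ j ∈ range n', (∑ m ∈ range (n' + 1), f m * f (m + (j + 1))) • ((!![0, 0, 0, -1; 1, 0, 0, 0; 0, 1, 0, 0; 0, 0, 1, 0] : Matrix (Fin 4) (Fin 4) ℤ)ᵀ) ^ (j + 1) = 0 :=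
              Finset.sum_eq_zero fun j hj => by
                rw [horth (j + 1) (Nat.succ_pos j) (by simp at hj; omega), zero_smul]
            rw [hzero, zero_add, pow_zero]
            congr 1
            rw [show ∑ m ∈ range (n' + 1), f m * f (m + 0) = ∑ m ∈ range (n' + 1), (1 : ℤ) from
              Finset.sum_congr rfl fun m _ => by rw [add_zero, pm_mul_self (hf m)]]
            simp
  -- S commutes with J
  have hcomm : Commute (!![0, 0, 0, -1; 1, 0, 0, 0; 0, 1, 0, 0; 0, 0, 1, 0] : Matrix (Fin 4) (Fin 4) ℤ) S :=
    Commute.sum_right _ _ _ fun m _ => ((Commute.refl (!![0, 0, 0, -1; 1, 0, 0, 0; 0, 1, 0, 0; 0, 0, 1, 0] : Matrix (Fin 4) (Fin 4) ℤ)).pow_right m).smul_right (f m)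
  have hJS := hcomm.eq
  -- the negacyclic relations among the entries of S
  have rel : ∀ i j : Fin 4, ((!![0, 0, 0, -1; 1, 0, 0, 0; 0, 1, 0, 0; 0, 0, 1, 0] : Matrix (Fin 4) (Fin 4) ℤ) * S) i j = (S * (!![0, 0, 0, -1; 1, 0, 0, 0; 0, 1, 0, 0; 0, 0, 1, 0] : Matrix (Fin 4) (Fin 4) ℤ)) i j := fun i j => by rw [hJS]
  have r00 := rel 0 0
  have r10 := rel 1 0
  have r01 := rel 0 1
  have r30 := rel 3 0
  have r02 := rel 0 2
  have r31 := rel 3 1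
  have r20 := rel 2 0
  have r11 := rel 1 1
  have r12 := rel 1 2
  simp [Matrix.mul_apply, Fin.sum_univ_four] at r00 r10 r01 r30 r02 r31 r20 r11 r12
  -- the (0,1) entry of S Sᵀ
  have h01 : (S * T) 0 1 = 0 := by
    rw [hST]; simp
  rw [Matrix.mul_apply, Fin.sum_univ_four, hTS, hTS, hTS, hTS] at h01
  -- parity of the first column of S
  have hpar : ∀ i : Fin 4, S i 0 % 2 = 1 := by
    intro i
    have hS : S i 0 = ∑ m ∈ range n, f m * ((!![0, 0, 0, -1; 1, 0, 0, 0; 0, 1, 0, 0; 0, 0, 1, 0] : Matrix (Fin 4) (Fin 4) ℤ) ^ m) i 0 := by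
      simp only [hSdef, Matrix.sum_apply, Matrix.smul_apply, smul_eq_mul]
    rw [hS, Finset.sum_congr rfl fun m _ => by rw [negJ_pow_col m i]]
    rw [← Finset.sum_filter_add_sum_filter_not (range n) (fun m => m % 4 = i.1)]
    have hz : ∑ m ∈ (range n).filter (fun m => ¬ m % 4 = i.1),
        f m * (if m % 8 = i.1 then 1 else if m % 8 = i.1 + 4 then -1 else 0) = 0 := by
      refine Finset.sum_eq_zero fun m hm => ?_
      simp only [Finset.mem_filter] at hm
      have h1 : m % 8 ≠ i.1 := by omega
      have h2 : m % 8 ≠ i.1 + 4 := by omega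
      rw [if_neg h1, if_neg h2, mul_zero]
    rw [hz, add_zero]
    have hodd : ∀ m ∈ (range n).filter (fun m => m % 4 = i.1),
        (f m * (if m % 8 = i.1 then 1 else if m % 8 = i.1 + 4 then -1 else 0)) % 2 = 1 := by
      intro m hm
      simp only [Finset.mem_filter] at hm
      have : m % 8 = i.1 ∨ m % 8 = i.1 + 4 := by omega
      rcases this with h | h
      · rw [if_pos h]; rcases hf m with h' | h' <;> rw [h'] <;> decide
      · have h1 : m % 8 ≠ i.1 := by omega
        rw [if_neg h1, if_pos h]; rcases hf m with h' | h' <;> rw [h'] <;> decide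
    rw [sum_odd_parity _ _ hodd]
    obtain ⟨u, hu⟩ : ∃ u, n = 8 * u + 4 := ⟨n / 8, by omega⟩
    rw [show n = 4 * (2 * u + 1) by omega, card_filter_range_mod_four (2 * u + 1) i.1 i.2]
    push_cast
    omega
  have ha := hpar 0
  have hb := hpar 1
  have hc := hpar 2
  have hd := hpar 3
  -- assemble: (S Sᵀ)₀₁ = ab + bc + cd − ad with a,b,c,d the first column
  have e01 : S 0 1 = -S 3 0 := by linarith
  have e11 : S 1 1 = S 0 0 := by linarith
  have e12 : S 1 2 = -S 3 0 := by linarith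
  have e02 : S 0 2 = -S 2 0 := by linarith
  have e13 : S 1 3 = -S 2 0 := by linarith
  have e03 : S 0 3 = -S 1 0 := by linarith
  rw [e01, e11, e12, e02, e13, e03] at h01
  have hC : S 0 0 * S 1 0 + S 1 0 * S 2 0 + S 2 0 * S 3 0 - S 0 0 * S 3 0 = 0 := by
    linear_combination h01
  exact odd_quad_ne_zero ha hb hc hd hC

/-- **Array form.**  No `±1` array `x : ℕ → ℕ → ℤ` that is shift-invariant (`x (k+1) (m+1) = x k m`), `n`-antiperiodic in both
variables (antiperiodicity in the second variable suffices), with orthogonal rows `Σ_{m<n} x 0 m · x k m = 0` (`0 < k < n`),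
exists when `n ≡ 4 (mod 8)` — i.e. no negacyclic
`±1` matrix `N` of order `n ≡ 4 (mod 8)` has `N Nᵀ = n I`. -/
theorem no_negacyclic_array (n : ℕ) (hn : n % 8 = 4) (x : ℕ → ℕ → ℤ) (hx : ∀ k m, x k m = 1 ∨ x k m = -1)
    (hshift : ∀ k m, x (k + 1) (m + 1) = x k m) (ham : ∀ k m, x k (m + n) = -x k m)
    (horth : ∀ k, 0 < k → k < n → ∑ m ∈ range n, x 0 m * x k m = 0) : False := by
  have hshift' : ∀ a k m, x (k + a) (m + a) = x k m := by
    intro a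
    induction a with
    | zero => intro k m; rfl
    | succ a ih => intro k m; rw [← add_assoc, ← add_assoc, hshift, ih]
  refine no_negacyclic_pm_seq n hn (fun t => x 0 t) (fun t => hx 0 t) (fun t => ham 0 t) ?_
  intro j hj0 hj
  -- f (m + j) = − x (n − j) m
  have e : ∀ m, x 0 (m + j) = -x (n - j) m := by
    intro m
    have h := hshift' (n - j) 0 (m + j)
    rw [zero_add, show m + j + (n - j) = m + n by omega, ham] at h
    linarith
  have h := horth (n - j) (by omega) (by omega)
  rw [show ∑ m ∈ range n, x 0 m * x 0 (m + j) = -∑ m ∈ range n, x 0 m * x (n - j) m from by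
    rw [← Finset.sum_neg_distrib]; exact Finset.sum_congr rfl fun m _ => by rw [e m]; ring]
  rw [h, neg_zero]

end main

end Summit.Ventures.DiscreteObjects.Hadamard
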